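import Literature.Geometry.Lorentzian.TameFamilyFarSurgery
import Literature.Geometry.Lorentzian.DataFamilyTangentKernel
import HarnessLib

/-!
# Crux `SettlingAlongCensoredKerrEnds` (stmt-FinalStateConjecture-18520), line `wall-cone-sections`,
# stub GU `stub_gaugeBorneUpgrade` — preparations for the GAUGED FAMILY (file 1 of 3)

The stub GU (crux-strategist, `Cruxes/SettlingAlongCensoredKerrEnds/Lines/wall_cone_sections.lean`)
says that a TAME curve of admissible data with settled members off `0` upgrades to a tame, injective,
immersed such curve through the same base datum. It is proved (file 3,
`ExactKerrEndsSettlingAlongCensoredKerrEndsGaugeBorneUpgrade.lean`) by the gauged family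
`F' c = (breathe (σ (c 0)))^* (H ((c 0)² e₀))` of file 2
(`ExactKerrEndsSettlingAlongCensoredKerrEndsGaugedFamily.lean`). This file holds the model-free
preparations, all proved, no definitions, no named facts:

* §1 the quadratic reparametrisation `ρ c = (c 0)² e₀` of `ℝ¹` (smooth, `ρ 0 = 0`, `ρ c ≠ 0` off `0`);
  two calculus lemmas in the shape consumed by file 2: differences of jointly smooth two-argument
  families are jointly smooth (`contDiffAt_uncurry_sub`), and the weighted `Cⁿ` suprema of a smooth
  family that VANISHES at the base parameter and far out tend to zero
  (`tendsto_iSup_weight_iteratedFDeriv_nhds_zero_of_base_zero`, the `Φ 0 = 0` form of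
  `Literature.Geometry.Lorentzian.tendsto_iSup_weight_iteratedFDeriv_sub_nhds_zero`);
* §2 TAME families restrict to collared ends `e.restrict _` (`isTameDataFamily_restrict`: soleness and
  DR decay are unchanged by the collar and the weighted distance only decreases, `wDist_restrict_le`).

References: Christodoulou, CQG 16 (1999) A23, p. A24 (genericity by lines in a fixed space of data);
Lee, *Introduction to Smooth Manifolds* (2013), Prop. 2.25; Bartnik–Isenberg 2004, §2 (diffeomorphism
covariance of the constraints); Choquet-Bruhat–Geroch, CMP 14 (1969), p. 330 (covariance of
developments); Dafermos–Rodnianski, arXiv:0811.0354, App. B.2.3 (the weights); Dieudonné 1960, (8.12.6).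
-/

-- the doubled `FinalStateConjecture.FinalStateConjecture` path component trips dupNamespace
set_option linter.dupNamespace false

noncomputable section

open Set Function Filter Metric TopologicalSpace Bundle
open scoped Manifold ContDiff Topology ENNReal

namespace Summit.FinalStateConjecture.FinalStateConjecture.Theorems.ExactKerrEnds

open Literature.Geometry.Lorentzian

namespace GaugeBorneUpgrade

/-! ### §1 The quadratic reparametrisation `ρ c = (c 0)² e₀` of `ℝ¹` -/

/-- `ρ c = (c 0)² e₀` is smooth. [folklore] -/
theorem contDiff_quad :
    ContDiff ℝ ∞ (fun c : EuclideanSpace ℝ (Fin 1) ↦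
      (EuclideanSpace.single 0 ((c 0) ^ 2) : EuclideanSpace ℝ (Fin 1))) :=
  InitialDataSet.contDiff_single_zero.comp
    ((contDiff_piLp_apply (𝕜 := ℝ) (n := ∞) (p := 2) (E := fun _ : Fin 1 => ℝ) (i := 0)).pow 2)

/-- `ρ 0 = 0`. [folklore] -/
theorem quad_zero :
    (EuclideanSpace.single 0 (((0 : EuclideanSpace ℝ (Fin 1)) 0) ^ 2) : EuclideanSpace ℝ (Fin 1)) = 0 := by
  simp

/-- `ρ c ≠ 0` for `c ≠ 0`. [folklore] -/
theorem quad_ne_zero {c : EuclideanSpace ℝ (Fin 1)} (hc : c ≠ 0) :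
    (EuclideanSpace.single 0 ((c 0) ^ 2) : EuclideanSpace ℝ (Fin 1)) ≠ 0 := by
  have hc0 : c 0 ≠ 0 := by
    intro h
    apply hc
    ext i
    rw [Subsingleton.elim i 0, h]
    rfl
  intro h
  have := congrArg (fun v : EuclideanSpace ℝ (Fin 1) ↦ v 0) h
  simp only [PiLp.single_apply, if_true, PiLp.zero_apply] at this
  exact pow_ne_zero 2 hc0 this

/-- **Differences of jointly smooth two-argument families are jointly smooth** (`ContDiffAt.sub`
read through `Function.uncurry`; stated with the families as variables so that the identification
`uncurry (A − B) = uncurry A − uncurry B` is checked on opaque symbols). [folklore] -/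
theorem contDiffAt_uncurry_sub {P : Type*} [NormedAddCommGroup P] [NormedSpace ℝ P]
    {F : Type*} [NormedAddCommGroup F] [NormedSpace ℝ F] {A A' : P → E3 → F} {q : P × E3}
    (hA : ContDiffAt ℝ ∞ (uncurry A) q) (hA' : ContDiffAt ℝ ∞ (uncurry A') q) :
    ContDiffAt ℝ ∞ (uncurry fun (c : P) (z : E3) ↦ A c z - A' c z) q := by
  have h : (uncurry fun (c : P) (z : E3) ↦ A c z - A' c z) = fun x ↦ uncurry A x - uncurry A' x := by
    funext x
    rfl
  rw [h]
  exact hA.sub hA'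

/-- **Weighted `Cⁿ`-suprema of a smooth family vanishing at the base parameter tend to zero**: the
form of `tendsto_iSup_weight_iteratedFDeriv_sub_nhds_zero` for a family `Φ` with `Φ 0 = 0` (then
`Φ c − Φ 0 = Φ c`; the rewriting is done here, on a generic normed space, once and for all).
Dieudonné 1960, (8.5.4), (8.12.6). [folklore] -/
theorem tendsto_iSup_weight_iteratedFDeriv_nhds_zero_of_base_zero
    {P : Type*} [NormedAddCommGroup P] [NormedSpace ℝ P] [ProperSpace P]
    {F : Type*} [NormedAddCommGroup F] [NormedSpace ℝ F]
    {Φ : P → E3 → F} {R R₁ R₂ : ℝ} (hR : R < R₁)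
    (hΦ : ∀ (c : P) (z : E3), R < ‖z‖ → ContDiffAt ℝ ∞ (uncurry Φ) (c, z))
    (hfar : ∀ (c : P) (z : E3), R₂ < ‖z‖ → Φ c z = Φ 0 z) (h0 : ∀ z : E3, Φ 0 z = 0) (n w : ℕ) :
    Tendsto (fun c : P ↦ ⨆ (i : ℕ) (_ : i ≤ n) (x : E3) (_ : R₁ < ‖x‖),
      ENNReal.ofReal (‖x‖ ^ (w + i)) * ‖iteratedFDeriv ℝ i (Φ c) x‖ₑ) (𝓝 0) (𝓝 0) := by
  have h := tendsto_iSup_weight_iteratedFDeriv_sub_nhds_zero hR hΦ hfar n w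
  have heq : ∀ c : P, (fun y ↦ Φ c y - Φ 0 y) = Φ c := fun c ↦ funext fun y ↦ by
    rw [h0 y, sub_zero]
  simp only [heq] at h
  exact h

/-! ### §2 Tame families restrict to collared ends -/

variable {X : Type} [TopologicalSpace X] [ChartedSpace E3 X] [IsManifold (𝓡 3) ∞ X]

/-- **The weighted distance on a collared end is dominated by the one on the end**:
`(e.restrict _).wDist D D' ≤ e.wDist D D'` (same integrands, smaller region `{R₁ < ‖x‖}`).
[cite: DafermosRodnianski2013, App. B.2.3] -/
theorem wDist_restrict_le (e : AFEnd X) {R₁ : ℝ} (hR₁ : e.R < R₁) (D D' : InitialDataSet (𝓡 3) X) :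
    (e.restrict hR₁.le).wDist D D' ≤ e.wDist D D' := by
  rw [e.wDist_restrict_eq hR₁.le D D']
  unfold AFEnd.wDist
  refine add_le_add ?_ ?_
  · refine iSup₂_le fun m hm ↦ iSup₂_le fun x hx ↦ ?_
    exact le_iSup₂_of_le m hm (le_iSup₂_of_le (f := fun (x : E3) (_ : e.R < ‖x‖) ↦
      ENNReal.ofReal (‖x‖ ^ (1 + m)) *
        ‖iteratedFDeriv ℝ m (fun y ↦ AFEnd.hCoeff e D y - AFEnd.hCoeff e D' y) x‖ₑ)
      x (hR₁.trans hx) le_rfl)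
  · refine iSup₂_le fun m hm ↦ iSup₂_le fun x hx ↦ ?_
    exact le_iSup₂_of_le m hm (le_iSup₂_of_le (f := fun (x : E3) (_ : e.R < ‖x‖) ↦
      ENNReal.ofReal (‖x‖ ^ (2 + m)) *
        ‖iteratedFDeriv ℝ m (fun y ↦ AFEnd.kCoeff e D y - AFEnd.kCoeff e D' y) x‖ₑ)
      x (hR₁.trans hx) le_rfl)

/-- **Tame families restrict to collared ends**: `F` tame on `e` is tame on `e.restrict _` for every
`R₁ > e.R` (soleness and DR decay are unchanged by the collar, `isSoleEnd_restrict_iff`,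
`isStronglyAsymptoticallyFlatDR_restrict_iff`; the weighted distance only decreases,
`wDist_restrict_le`). [cite: Christodoulou1999, p. A24] -/
theorem isTameDataFamily_restrict {e : AFEnd X} {m : ℕ}
    {F : EuclideanSpace ℝ (Fin m) → InitialDataSet (𝓡 3) X}
    (hF : InitialDataSet.IsTameDataFamily e m F) {R₁ : ℝ} (hR₁ : e.R < R₁) :
    InitialDataSet.IsTameDataFamily (e.restrict hR₁.le) m F := by
  obtain ⟨hs, hsole, ⟨M, hM, hSAF⟩, hlim⟩ := hF
  refine ⟨hs, (e.isSoleEnd_restrict_iff hR₁.le).2 hsole,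
    ⟨M, hM, fun c ↦ (e.isStronglyAsymptoticallyFlatDR_restrict_iff hR₁.le _ _).2 (hSAF c)⟩, ?_⟩
  exact tendsto_of_tendsto_of_tendsto_of_le_of_le tendsto_const_nhds hlim (fun _ ↦ zero_le)
    fun c ↦ wDist_restrict_le e hR₁ (F c) (F 0)

end GaugeBorneUpgrade

/-- **Registered sub-goal `stub_isTameDataFamily_restrict` of the crux item (stmt-FinalStateConjecture-18520)
— TAME FAMILIES RESTRICT TO COLLARED ENDS** (closed form of `GaugeBorneUpgrade.isTameDataFamily_restrict`,
the form in which gauge constructions on a collar `e.restrict _` consume a tame input family).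
[cite: Christodoulou1999, p. A24] -/
theorem stub_isTameDataFamily_restrict : ∀ (X : Type) [TopologicalSpace X] [ChartedSpace E3 X] [IsManifold (𝓡 3) ∞ X] (e : AFEnd X) (m : ℕ) (F : EuclideanSpace ℝ (Fin m) → InitialDataSet (𝓡 3) X) (R₁ : ℝ) (hR₁ : e.R < R₁), InitialDataSet.IsTameDataFamily e m F → InitialDataSet.IsTameDataFamily (e.restrict hR₁.le) m F :=
  fun _ _ _ _ _ _ _ _ hR₁ hF ↦ GaugeBorneUpgrade.isTameDataFamily_restrict hF hR₁

end Summit.FinalStateConjecture.FinalStateConjecture.Theorems.ExactKerrEnds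

end
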